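import Literature.NumberTheory.LFunctions.ExplicitPNTNonExceptionalModuli
import Literature.NumberTheory.LFunctions.NoRealZeroUpTo
import Literature.NumberTheory.LFunctions.RealCharacterLadderLeaves
import Literature.NumberTheory.LFunctions.NoExceptionalZeroUpToTenPowTen
import Mathlib.NumberTheory.Chebyshev
import HarnessLib

/-!
# Quasi-polynomial least prime in an arithmetic progression over a certified no-exceptional-zero
# range (consumer C3a of the column REALCHAR)

Topic `Literature/NumberTheory/LFunctions`; namespace `Literature.NumberTheory.LFunctions.BMOR2018`.
No named fact is introduced here. This file PROVES the consumer C3a of the cell `parity-realchar`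
(HOME/CONSUMERS.md §C3a, theory memo TARGET.md §(ii); typed shape
`PsiBoundNonExcUpTo → LeastPrimeQuasiPolyUpTo` of the theory seat's Sketch2): from the `ψ`-bound
SHAPE that the tree theorem `BMOR2018.psi_bound_of_noExceptionalZeroUpTo` concludes (Bennett–Martin–
O'Bryant–Rechnitzer 2018, Lemma 6.12, non-exceptional clause, consumed over a table
`NoExceptionalZeroUpTo Q c₀` with `c₀ ≥ 1/R₁`), every reduced class `a mod q`, `10⁵ ≤ q ≤ Q`,
contains a PRIME `p ≤ exp(4 R₁ log² q) = q^{4 R₁ log q}` (`R₁ = 9.645908801`).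

## The argument (one evaluation of the `ψ`-bound)

Put `X = exp(4R₁ log² q)`. The bound at `x = X` reads `|ψ(X; q, a) − X/φ(q)| ≤ errTerm X` with
`errTerm X = 1.4579 · X · 2 log q · q⁻²` EXACTLY (`√(log X / R₁) = 2 log q`), so
`ψ(X; q, a) ≥ X/q − 2.9158 X log q / q² ≥ (49/50) · X/q` for `q ≥ 10⁵` (`log q ≤ 2√q`). The prime
powers `p^k`, `k ≥ 2`, contribute to `ψ(X; q, a)` at most `ψ(X) − θ(X) ≤ 2 √X log X` (Mathlib
`Chebyshev.psi_sub_theta_le`), and `2 √X log X < (49/50) X/q` because `√X = exp(2R₁ log² q) ≥ q³`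
while `log X = 4R₁ log² q ≤ 16 R₁ q`. Hence some PRIME `p ≤ X` has `p ≡ a (mod q)`.
(The source proves the `ψ`-bound; the least-prime corollary in this quasi-polynomial form is
folklore bookkeeping — de la Vallée-Poussin range `log x ≍ log² q` — and is not claimed there.)

## Contents

* `BMOR2018.PsiBoundUpTo Q` — the SHAPE concluded by `psi_bound_of_noExceptionalZeroUpTo` for all
  `10⁵ ≤ q ≤ Q` (a `def`, used as a hypothesis; supplied by `psiBoundUpTo_of_noExceptionalZeroUpTo`).
* `BMOR2018.LeastPrimeQuasiPolyUpTo Q` — C3a: for `10⁵ ≤ q ≤ Q` and every unit `a`, a prime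
  `p ≡ a (mod q)` with `p ≤ exp(4R₁ log² q)`.
* `BMOR2018.exists_prime_le_of_psi_sub_theta_lt` — the combinatorial step: if
  `ψ(X) − θ(X) < ψ(X; q, a)` then a prime `p ≤ X` lies in the class `a`.
* `BMOR2018.leastPrimeQuasiPolyUpTo_of_psiBoundUpTo` — **C3a PROVED** from the shape;
  `leastPrime_of_noExceptionalZeroUpTo` (table form, conditional on the named fact `lemma612_psi`
  exactly like the `ψ`-bound), `leastPrime_of_noRealZeroUpTo` (wide-table form), and the instances
  over Platt's printed range (`leastPrime_platt`) and over the decade leaf `NoRealZeroUpTo_1e10` of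
  the cell (`leastPrime_upTo_1e10`: every `10⁵ ≤ q ≤ 10¹⁰`).

WHAT THIS IS NOT: not a polynomial Linnik bound (the exponent `4R₁ log q` grows); nothing for
`q < 10⁵` or `q > Q`; conditional on `lemma612_psi` (BMOR Lemma 6.12 as printed, not discharged in
the tree) and on the table hypothesis.

## References

* M. A. Bennett, G. Martin, K. O'Bryant, A. Rechnitzer, *Explicit bounds for primes in arithmetic
  progressions*, Illinois J. Math. 62 (2018) 427–532, Definition 6.1, Lemma 6.12.
  [BennettMartinOBryantRechnitzer2018]
* D. J. Platt, Math. Comp. 85 (2016) 3009–3027, Theorem 7.1. [Platt2016GRH]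
-/

noncomputable section

open Finset Real Chebyshev

namespace Literature.NumberTheory.LFunctions

namespace BMOR2018

/-! ### The two shapes -/

/-- The SHAPE concluded by `psi_bound_of_noExceptionalZeroUpTo` (Bennett–Martin–O'Bryant–Rechnitzer
Lemma 6.12, non-exceptional clause) uniformly over a range of moduli: for every `10⁵ ≤ q ≤ Q`,
every unit `a` mod `q` and every `x ≥ exp(4R₁ log² q)`, `|ψ(x; q, a) − x/φ(q)| ≤ errTerm x`.
A `def` used as a hypothesis (no fact asserted). [cite: BennettMartinOBryantRechnitzer2018, Lemma 6.12] -/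
def PsiBoundUpTo (Q : ℕ) : Prop :=
  ∀ (q : ℕ) [NeZero q], 10 ^ 5 ≤ q → q ≤ Q → ∀ (a : (ZMod q)ˣ) (x : ℝ),
    Real.exp (4 * R₁ * Real.log q ^ 2) ≤ x →
      |Literature.NumberTheory.Sieve.ParityWave0.chebyshevPsiMod q a x - x / q.totient| ≤ errTerm x

/-- **C3a (shape).** Quasi-polynomial least prime for the moduli of a table: for every
`10⁵ ≤ q ≤ Q` and every unit `a` mod `q` there is a prime `p ≡ a (mod q)` with
`p ≤ exp(4R₁ log² q) = q^{4R₁ log q}`. A `def` (no fact asserted); proved below from `PsiBoundUpTo Q`.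
[cite: BennettMartinOBryantRechnitzer2018, Lemma 6.12] -/
def LeastPrimeQuasiPolyUpTo (Q : ℕ) : Prop :=
  ∀ (q : ℕ) [NeZero q], 10 ^ 5 ≤ q → q ≤ Q → ∀ a : (ZMod q)ˣ,
    ∃ p : ℕ, p.Prime ∧ (p : ZMod q) = (a : ZMod q) ∧
      (p : ℝ) ≤ Real.exp (4 * R₁ * Real.log q ^ 2)

/-- The table supplies the shape: `lemma612_psi → NoExceptionalZeroUpTo Q c₀ → 1/R₁ ≤ c₀ →
PsiBoundUpTo Q` (this is `psi_bound_of_noExceptionalZeroUpTo`, quantified).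
[cite: BennettMartinOBryantRechnitzer2018, Lemma 6.12] -/
theorem psiBoundUpTo_of_noExceptionalZeroUpTo (h612 : lemma612_psi) {Q : ℕ} {c₀ : ℝ}
    (hN : NoExceptionalZeroUpTo Q c₀) (hc : 1 / R₁ ≤ c₀) : PsiBoundUpTo Q :=
  fun _q _ hq hqQ a _x hx ↦ psi_bound_of_noExceptionalZeroUpTo h612 hN hc hq hqQ a hx

/-- `LeastPrimeQuasiPolyUpTo` is antitone in the level. [cite: BennettMartinOBryantRechnitzer2018, Lemma 6.12] -/
theorem LeastPrimeQuasiPolyUpTo.anti_level {Q Q' : ℕ} (h : LeastPrimeQuasiPolyUpTo Q) (hQ : Q' ≤ Q) :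
    LeastPrimeQuasiPolyUpTo Q' :=
  fun q _ hq hqQ a ↦ h q hq (hqQ.trans hQ) a

/-! ### The combinatorial step: primes versus prime powers in `ψ(X; q, a)` -/

/-- If the prime-power mass `ψ(X) − θ(X)` is smaller than `ψ(X; q, a)`, then some PRIME `p ≤ X` lies
in the class `a` mod `q` (all three functions are sums over `n ≤ ⌊X⌋`; a prime outside the class and
a prime power contribute to `ψ(X; q, a)` at most what they contribute to `ψ(X) − θ(X)`).
[cite: BennettMartinOBryantRechnitzer2018, Lemma 6.12] -/
theorem exists_prime_le_of_psi_sub_theta_lt {q : ℕ} (a : ZMod q) {X : ℝ} (hX : 0 ≤ X)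
    (h : psi X - theta X < Literature.NumberTheory.Sieve.ParityWave0.chebyshevPsiMod q a X) :
    ∃ p : ℕ, p.Prime ∧ (p : ZMod q) = a ∧ (p : ℝ) ≤ X := by
  by_contra hne
  push Not at hne
  suffices hle : Literature.NumberTheory.Sieve.ParityWave0.chebyshevPsiMod q a X ≤ psi X - theta X from
    (not_lt.mpr hle) h
  -- write all three as sums over `Icc 0 ⌊X⌋₊`
  rw [psi_eq_sum_Icc, theta_eq_sum_Icc, sum_filter, ← sum_sub_distrib]
  unfold Literature.NumberTheory.Sieve.ParityWave0.chebyshevPsiMod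
  rw [Nat.range_succ_eq_Icc_zero]
  refine sum_le_sum fun n hn ↦ ?_
  have hnX : (n : ℝ) ≤ X := by
    have hn' : n ≤ ⌊X⌋₊ := (mem_Icc.mp hn).2
    exact (Nat.cast_le.mpr hn').trans (Nat.floor_le hX)
  by_cases hp : n.Prime
  · -- a prime: in the class it would contradict `hne`; outside the class it contributes `0`
    rw [if_pos hp, ArithmeticFunction.vonMangoldt_apply_prime hp, sub_self]
    have hna : (n : ZMod q) ≠ a := fun hna ↦ (not_lt.mpr hnX) (hne n hp hna)
    have hmem : n ∉ {m : ℕ | (m : ZMod q) = a} := hna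
    simp [Set.indicator_of_notMem hmem]
  · rw [if_neg hp, sub_zero]
    exact ArithmeticFunction.vonMangoldt.residueClass_le a n

/-! ### Elementary inequalities at `X = exp(4R₁ log² q)` -/

/-- `log q ≤ 2 √q` for `0 < q` (from `log √q ≤ √q − 1`). [folklore] -/
private theorem log_le_two_mul_sqrt {y : ℝ} (hy : 0 < y) : Real.log y ≤ 2 * Real.sqrt y := by
  have hs : 0 < Real.sqrt y := Real.sqrt_pos.mpr hy
  have h1 : Real.log (Real.sqrt y) ≤ Real.sqrt y - 1 := Real.log_le_sub_one_of_pos hs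
  rw [Real.log_sqrt hy.le] at h1
  linarith

/-- The error term at `X = exp(4R₁ log² q)` in closed form:
`errTerm X = 1.4579 · X · (2 log q) · exp(−2 log q)` (for `1 ≤ q`, so that `log q ≥ 0`).
[cite: BennettMartinOBryantRechnitzer2018, Lemma 6.12] -/
theorem errTerm_exp_eq {t : ℝ} (ht : 0 ≤ t) :
    errTerm (Real.exp (4 * R₁ * t ^ 2)) =
      1.4579 * Real.exp (4 * R₁ * t ^ 2) * (2 * t) * Real.exp (-(2 * t)) := by
  unfold errTerm
  have hR : 0 < R₁ := R₁_pos
  have hlog : Real.log (Real.exp (4 * R₁ * t ^ 2)) / R₁ = (2 * t) ^ 2 := by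
    rw [Real.log_exp]; field_simp; ring
  rw [hlog, Real.sqrt_sq (by positivity)]

set_option maxHeartbeats 400000 in
/-- The main inequality: for `q ≥ 10⁵` (as a real number) and `X = exp(4R₁ log² q)`,
`2 √X log X < X/q − errTerm X`. [cite: BennettMartinOBryantRechnitzer2018, Lemma 6.12] -/
theorem two_sqrt_mul_log_lt {q : ℝ} (hq : (10 : ℝ) ^ 5 ≤ q) :
    2 * Real.sqrt (Real.exp (4 * R₁ * Real.log q ^ 2)) * Real.log (Real.exp (4 * R₁ * Real.log q ^ 2))
      < Real.exp (4 * R₁ * Real.log q ^ 2) / q - errTerm (Real.exp (4 * R₁ * Real.log q ^ 2)) := by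
  have hR : 0 < R₁ := R₁_pos
  have hq0 : 0 < q := lt_of_lt_of_le (by norm_num) hq
  have hq1 : (1 : ℝ) ≤ q := le_trans (by norm_num) hq
  set t : ℝ := Real.log q with ht_def
  have ht0 : 0 ≤ t := Real.log_nonneg hq1
  -- `t ≥ 1` : `q ≥ 10⁵ > e`
  have ht1 : 1 ≤ t := by
    rw [ht_def, Real.le_log_iff_exp_le hq0]
    have := Real.exp_one_lt_d9
    linarith
  -- `t ≤ 2 √q` and `√q ≥ 316`
  have htq : t ≤ 2 * Real.sqrt q := log_le_two_mul_sqrt hq0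
  have hsq : (316 : ℝ) ≤ Real.sqrt q := by
    rw [show (316 : ℝ) = Real.sqrt (316 ^ 2) by rw [Real.sqrt_sq (by norm_num)]]
    exact Real.sqrt_le_sqrt (by nlinarith)
  have hsq0 : 0 < Real.sqrt q := by linarith
  have hsqq : Real.sqrt q * Real.sqrt q = q := Real.mul_self_sqrt hq0.le
  -- the square root and the logarithm of `X`
  set S : ℝ := Real.exp (2 * R₁ * t ^ 2) with hS_def
  have hS0 : 0 < S := Real.exp_pos _
  have hX : Real.exp (4 * R₁ * t ^ 2) = S * S := by
    rw [hS_def, ← Real.exp_add]; ring_nf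
  have hsqrtX : Real.sqrt (Real.exp (4 * R₁ * t ^ 2)) = S := by
    rw [hX, Real.sqrt_mul_self hS0.le]
  have hlogX : Real.log (Real.exp (4 * R₁ * t ^ 2)) = 4 * R₁ * t ^ 2 := Real.log_exp _
  -- `S ≥ q³`
  have hS3 : q ^ 3 ≤ S := by
    have h3 : Real.exp (3 * t) = q ^ 3 := by
      rw [show (3 : ℝ) * t = ((3 : ℕ) : ℝ) * t by norm_num, Real.exp_nat_mul, ht_def,
        Real.exp_log hq0]
    rw [← h3, hS_def]
    apply Real.exp_le_exp.mpr
    have : 3 * t ≤ 2 * R₁ * t * t := by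
      have h19 : (3 : ℝ) ≤ 2 * R₁ * t := by unfold R₁; nlinarith
      nlinarith
    nlinarith
  -- the error term at `X`
  have herr : errTerm (Real.exp (4 * R₁ * t ^ 2)) = 1.4579 * (S * S) * (2 * t) * Real.exp (-(2 * t)) := by
    rw [errTerm_exp_eq ht0, hX]
  have hexp2 : Real.exp (-(2 * t)) = 1 / (q * q) := by
    rw [Real.exp_neg, show (2 : ℝ) * t = ((2 : ℕ) : ℝ) * t by norm_num, Real.exp_nat_mul, ht_def,
      Real.exp_log hq0]
    field_simp
  -- errTerm X ≤ X/(50 q)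
  have herr_le : errTerm (Real.exp (4 * R₁ * t ^ 2)) ≤ S * S / (50 * q) := by
    rw [herr, hexp2]
    rw [show 1.4579 * (S * S) * (2 * t) * (1 / (q * q)) = (2.9158 * t * (S * S)) / (q * q) by ring]
    rw [div_le_div_iff₀ (by positivity) (by positivity)]
    -- 2.9158 t S² (50 q) ≤ S² q²  ⟸ 145.79 t ≤ q
    have hkey : 145.79 * t ≤ q := by
      calc 145.79 * t ≤ 145.79 * (2 * Real.sqrt q) := by nlinarith
        _ ≤ Real.sqrt q * Real.sqrt q := by nlinarith
        _ = q := hsqq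
    have h' : S * S * q * (145.79 * t) ≤ S * S * q * q :=
      mul_le_mul_of_nonneg_left hkey (by positivity)
    nlinarith [h']
  -- log X ≤ 16 R₁ q
  have ht2 : t ^ 2 ≤ 4 * q := by
    have := mul_le_mul htq htq ht0 (by positivity)
    nlinarith [this, hsqq]
  have hlogX_le : 4 * R₁ * t ^ 2 ≤ 16 * R₁ * q := by nlinarith [mul_le_mul_of_nonneg_left ht2 hR.le]
  have hXq : Real.exp (4 * R₁ * t ^ 2) / q = S * S / q := by rw [hX]
  rw [hsqrtX, hlogX, hXq]
  -- Goal: 2 * S * (4 R₁ t²) < S*S/q − errTerm X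
  have hgoal : 2 * S * (4 * R₁ * t ^ 2) + S * S / (50 * q) < S * S / q := by
    have h1 : 2 * S * (4 * R₁ * t ^ 2) ≤ 2 * S * (16 * R₁ * q) :=
      mul_le_mul_of_nonneg_left hlogX_le (by positivity)
    -- S*S/q − S*S/(50q) = (49/50) S (S/q) ≥ (49/50) S q² and 32 R₁ q S < (49/50) q² S since q ≥ 10⁵
    have hSq : q ^ 2 ≤ S / q := by
      rw [le_div_iff₀ hq0]; nlinarith
    have h32 : 2 * (16 * R₁ * q) < (49 / 50) * q ^ 2 := by
      unfold R₁; nlinarith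
    have e1 := mul_lt_mul_of_pos_left h32 hS0
    have e2 : S * (49 / 50) * q ^ 2 ≤ S * (49 / 50) * (S / q) :=
      mul_le_mul_of_nonneg_left hSq (by positivity)
    have e3 : S * S / q = S * (S / q) := by ring
    have e4 : S * S / (50 * q) = S * (S / q) / 50 := by field_simp
    rw [e3, e4]
    nlinarith [e1, e2]
  linarith

/-! ### C3a proved -/

/-- **C3a PROVED from the shape.** If `|ψ(x; q, a) − x/φ(q)| ≤ errTerm x` for all `10⁵ ≤ q ≤ Q`,
units `a`, `x ≥ exp(4R₁ log² q)`, then every such class contains a prime `p ≤ exp(4R₁ log² q)`.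
[cite: BennettMartinOBryantRechnitzer2018, Lemma 6.12] -/
theorem leastPrimeQuasiPolyUpTo_of_psiBoundUpTo {Q : ℕ} (h : PsiBoundUpTo Q) :
    LeastPrimeQuasiPolyUpTo Q := by
  intro q _ hq hqQ a
  set X : ℝ := Real.exp (4 * R₁ * Real.log q ^ 2) with hX_def
  have hqr : (10 : ℝ) ^ 5 ≤ q := by exact_mod_cast hq
  have hq0 : (0 : ℝ) < q := lt_of_lt_of_le (by norm_num) hqr
  have hX0 : 0 ≤ X := (Real.exp_pos _).le
  have hX1 : 1 ≤ X := by
    rw [hX_def]; exact Real.one_le_exp (by have := R₁_pos; positivity)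
  -- the ψ-bound at `x = X`
  have hb := h q hq hqQ a X le_rfl
  have hlow : X / q.totient - errTerm X ≤
      Literature.NumberTheory.Sieve.ParityWave0.chebyshevPsiMod q a X := by
    have := (abs_le.mp hb).1; linarith
  -- `X/φ(q) ≥ X/q`
  have htot0 : (0 : ℝ) < q.totient := by exact_mod_cast Nat.totient_pos.mpr (NeZero.pos q)
  have htotq : (q.totient : ℝ) ≤ q := by exact_mod_cast Nat.totient_le q
  have hdiv : X / q ≤ X / q.totient := div_le_div_of_nonneg_left hX0 htot0 htotq
  -- prime powers
  have hpt : psi X - theta X ≤ 2 * Real.sqrt X * Real.log X := psi_sub_theta_le hX1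
  have hmain := two_sqrt_mul_log_lt hqr
  obtain ⟨p, hp, hpa, hpX⟩ := exists_prime_le_of_psi_sub_theta_lt (a : ZMod q) hX0 (by linarith)
  exact ⟨p, hp, hpa, hpX⟩

/-- **C3a, table form.** Assume the named fact `lemma612_psi` (BMOR Lemma 6.12 as printed) and a
table `NoExceptionalZeroUpTo Q c₀` with `1/R₁ ≤ c₀`. Then for every `10⁵ ≤ q ≤ Q` and every unit `a`
mod `q` there is a prime `p ≡ a (mod q)`, `p ≤ exp(4R₁ log² q)`.
[cite: BennettMartinOBryantRechnitzer2018, Lemma 6.12] -/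
theorem leastPrime_of_noExceptionalZeroUpTo (h612 : lemma612_psi) {Q : ℕ} {c₀ : ℝ}
    (hN : NoExceptionalZeroUpTo Q c₀) (hc : 1 / R₁ ≤ c₀) : LeastPrimeQuasiPolyUpTo Q :=
  leastPrimeQuasiPolyUpTo_of_psiBoundUpTo (psiBoundUpTo_of_noExceptionalZeroUpTo h612 hN hc)

/-- **C3a, wide-table form.** `lemma612_psi → NoRealZeroUpTo Q → LeastPrimeQuasiPolyUpTo Q`
(a wide table gives the narrow one at width `c₀ = 1/R₁`, `NoRealZeroUpTo.noExceptionalZeroUpTo`).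
[cite: BennettMartinOBryantRechnitzer2018, Lemma 6.12] -/
theorem leastPrime_of_noRealZeroUpTo (h612 : lemma612_psi) {Q : ℕ} (hW : NoRealZeroUpTo Q) :
    LeastPrimeQuasiPolyUpTo Q :=
  leastPrime_of_noExceptionalZeroUpTo h612 (hW.noExceptionalZeroUpTo (1 / R₁)) le_rfl

/-- The same with the bound spelled out in the weaker printed-style form `p ≤ 2·exp(4R₁ log² q)`
(the theory seat's typed shape). [cite: BennettMartinOBryantRechnitzer2018, Lemma 6.12] -/
theorem LeastPrimeQuasiPolyUpTo.two_mul {Q : ℕ} (h : LeastPrimeQuasiPolyUpTo Q) (q : ℕ) [NeZero q]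
    (hq : 10 ^ 5 ≤ q) (hqQ : q ≤ Q) (a : (ZMod q)ˣ) :
    ∃ p : ℕ, p.Prime ∧ (p : ZMod q) = (a : ZMod q) ∧
      (p : ℝ) ≤ 2 * Real.exp (4 * 9.645908801 * Real.log q ^ 2) := by
  obtain ⟨p, hp, hpa, hpX⟩ := h q hq hqQ a
  refine ⟨p, hp, hpa, hpX.trans ?_⟩
  have : (0 : ℝ) ≤ Real.exp (4 * R₁ * Real.log q ^ 2) := (Real.exp_pos _).le
  unfold R₁ at hpX this ⊢
  linarith

/-! ### Instances of record -/

/-- **Over Platt's printed range** (conditional on the two named facts `platt2016_theorem71` and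
`lemma612_psi`): for every `10⁵ ≤ q ≤ 4·10⁵` and every unit `a` mod `q` there is a prime
`p ≡ a (mod q)` with `p ≤ exp(4R₁ log² q)`. [cite: Platt2016GRH, Theorem 7.1] -/
theorem leastPrime_platt (hP : platt2016_theorem71) (h612 : lemma612_psi) :
    LeastPrimeQuasiPolyUpTo 400000 :=
  leastPrime_of_noExceptionalZeroUpTo h612 (noExceptionalZeroUpTo_platt hP) (by unfold R₁; norm_num)

/-- **Over the decade leaf of the `parity-realchar` cell** (conditional on `lemma612_psi` and on the
value-free leaf `NoRealZeroUpTo_1e10` taken as a hypothesis — the cell's certified numerics, not a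
kernel fact): for every `10⁵ ≤ q ≤ 10¹⁰` and every unit `a` mod `q` there is a prime
`p ≡ a (mod q)` with `p ≤ exp(4R₁ log² q)`. [cite: BennettMartinOBryantRechnitzer2018, Lemma 6.12] -/
theorem leastPrime_upTo_1e10 (h612 : lemma612_psi) (h10 : NoRealZeroUpTo_1e10) :
    LeastPrimeQuasiPolyUpTo 10000000000 :=
  leastPrime_of_noRealZeroUpTo h612 h10

/-- The same over the wide rung leaf `NoRealZeroUpTo_3e10` (`3·10¹⁰`; odd route F ∧ even route G of
the cell, value-free hypothesis). [cite: BennettMartinOBryantRechnitzer2018, Lemma 6.12] -/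
theorem leastPrime_upTo_3e10 (h612 : lemma612_psi) (h30 : NoRealZeroUpTo_3e10) :
    LeastPrimeQuasiPolyUpTo 30000000000 :=
  leastPrime_of_noRealZeroUpTo h612 h30

/-- **Over Lu–Zaman–Zhao's printed narrow range `q ≤ 10¹⁰`** (PRINT-ONLY chain, conditional on the
two named facts `luZamanZhao2026_theorem11` — no quadratic `χ` mod `q ≤ 10¹⁰` has a zero in
`[1 − 1/(5 log q), 1]`, giving `NoExceptionalZeroUpTo 10¹⁰ (1/5)` by
`noExceptionalZeroUpTo_of_luZamanZhao`, width `1/5 ≥ 1/R₁` — and `lemma612_psi`): for every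
`10⁵ ≤ q ≤ 10¹⁰` and every unit `a` mod `q` there is a prime `p ≡ a (mod q)` with
`p ≤ exp(4R₁ log² q)`. The same range as `leastPrime_upTo_1e10`, resting on the printed theorem
instead of the cell's certified leaf. [cite: LuZamanZhao2026, Theorem 1.1] -/
theorem leastPrime_luZamanZhao (h11 : luZamanZhao2026_theorem11) (h612 : lemma612_psi) :
    LeastPrimeQuasiPolyUpTo (10 ^ 10) :=
  leastPrime_of_noExceptionalZeroUpTo h612 (noExceptionalZeroUpTo_of_luZamanZhao h11)
    (by unfold R₁; norm_num)

end BMOR2018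

end Literature.NumberTheory.LFunctions

end
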